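import Literature.Computability.Complexity.RandomKSatThreshold
import Mathlib.Algebra.BigOperators.Ring.Finset
import Mathlib.Algebra.BigOperators.Group.Finset.Piecewise
import Mathlib.Algebra.Order.Chebyshev
import Mathlib.Data.Nat.Choose.Sum
import HarnessLib

/-!
# Weighted and balanced counts of satisfying assignments of random `k`-CNF formulas:
# the first and second moment identities of Achlioptas–Peres

The combinatorial layer (§3 "Groundwork" and §7 "Truncation and weighting" of
D. Achlioptas, Y. Peres, *The threshold for random `k`-SAT is `2^k log 2 - O(k)`*, J. Amer. Math.
Soc. 17 (2004); arXiv:cs/0305009 pp. 8–9, 14–15) of the proof of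
`AchlioptasPeres2004_threshold_lower_bound`, in the with-replacement literal-array model of
`RandomKSatThreshold.lean` (`Φ : Fin m → Fin k → Fin n × Bool`, literal `(v, b)` true under `σ` iff
`σ v = b`). Everything is a finite sum; "expectation" means the sum over all `(2n)^{km}` arrays.

NORMALISATION. The paper weights a satisfying assignment by `γ^{H(σ,F)}`, `H` = (#satisfied −
#unsatisfied literal occurrences) `= 2 S(σ,F) - km`. We use `λ = γ²` and the weight
`λ^{S(σ,F)} = γ^{km} · γ^{H}`; the common factor `γ^{km}` cancels in every ratio used
(`E[X]²/E[X²]`), so nothing is lost, and all exponents are natural numbers.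

## Definitions (sub-namespace `RandomKSat`)

* `satCount σ c` — number `s` of literal occurrences of the clause `c : Fin k → Fin n × Bool`
  satisfied by `σ`; `clauseWeight λ σ c = λ^s · 1[s ≥ 1]` (zero iff `σ` falsifies `c`);
  `assignmentWeight λ σ Φ = ∏_i clauseWeight λ σ (Φ i)` (`= λ^{S(σ,Φ)} 1[σ ⊨ Φ]`,
  `assignmentWeight_eq`); `totalSat σ Φ = S(σ, Φ) = Σ_i s_i`.
* `weightedCount λ Φ = X = Σ_σ assignmentWeight` and the BALANCED (truncated) count
  `balancedCount λ Φ = X₊ = Σ_{σ : 2 S(σ,Φ) ≥ km} assignmentWeight` (AP §7: `H(σ,F) ≥ 0`).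
* `overlap σ τ = z` = number of variables on which `σ, τ` agree; `pairPoly k λ α = F_λ(α) =
  (αλ² + α + 2λ(1-α))^k - 2(α + λ(1-α))^k + α^k` — the pair-correlation function `f(α)` of
  AP eq. (18)/(19) (with `λ = 1 - ε`: `2 - 2ε + αε² = αλ² + α + 2λ(1-α)`, `1 - ε + αε = α + λ(1-α)`).

## Results (all proved)

* per-literal sums (`sum_literals_ite`, `sum_literals_ite_mul_ite`): a fixed `σ` satisfies exactly
  `n` of the `2n` literals; a pair `σ, τ` of overlap `z` sees `(true,true)`/`(false,false)` on
  `z` literals each and `(true,false)`/`(false,true)` on `n - z` each;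
* per-clause sums factor over the `k` i.i.d. literals (`Fintype.sum_pow`):
  `Σ_c clauseWeight λ σ c = n^k ((1+λ)^k - 1)` (`sum_clauseWeight`, AP (17): `ψ`) and
  `Σ_c clauseWeight λ σ c · clauseWeight λ τ c = (zλ²+z+2λ(n-z))^k - 2(z+λ(n-z))^k + z^k
  = n^k F_λ(z/n)` (`sum_clauseWeight_mul`, `sum_clauseWeight_mul_eq_pairPoly`, AP (18)),
  `F_λ(1/2) = ((1+λ)^k-1)²/2^k` (`pairPoly_half`, AP (25));
* sums over arrays factor over the `m` i.i.d. clauses: `Σ_Φ X = 2^n (n^k((1+λ)^k-1))^m`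
  (`sum_weightedCount`, AP (17)), `Σ_Φ W_λ(σ)W_λ(τ) = (Σ_c w w)^m` (`sum_assignmentWeight_mul`,
  AP (20));
* pair counting `Σ_{σ,τ} g(overlap σ τ) = 2^n Σ_z C(n,z) g(z)` (`sum_sum_overlap`, AP (21)), via the
  equivalence `agreementEquiv σ : assignments ≃ subsets` (`τ ↦ {v | σ v = τ v}`);
* the truncation trick of AP §7 (49)–(50): for `0 ≤ λ ≤ λ'`, on balanced pairs
  `W_λ(σ)W_λ(τ) ≤ (λ/λ')^{km} W_{λ'}(σ)W_{λ'}(τ)` (`balanced_pair_le`), whence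
  `Σ_Φ X₊² ≤ Σ_{σ,τ} min((Σ_c w_λ w_λ)^m, (λ/λ')^{km}(Σ_c w_{λ'} w_{λ'})^m)`
  (`sum_balancedCount_sq_le`);
* the second-moment inequality in counting form (AP Lemma 1, by Cauchy–Schwarz
  `sq_sum_le_card_pos_mul_sum_sq`): `(Σ_Φ X₊)² ≤ #{Φ satisfiable} · Σ_Φ X₊²`
  (`sq_sum_balancedCount_le`), since `X₊(Φ) > 0` forces `Φ` satisfiable
  (`litArraySat_of_balancedCount_pos`).

Not here (later files): the comparison `Σ_Φ X₊ ≥ c Σ_Φ X` (AP Lemma 7), the analysis of `F_λ`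
(AP §§4–6, 9), the Laplace bound (`Literature/Combinatorics/BinomialLaplaceBound.lean`) and the
assembly.
-/

noncomputable section

namespace Literature.Computability.Complexity

open Finset
open scoped Classical

namespace RandomKSat

variable {n k m : ℕ}

/-! ### Definitions -/

/-- The number `s = S(σ, c)` of literal occurrences of the clause `c` that `σ` satisfies
(literal `(v, b)` is true under `σ` iff `σ v = b`). [cite: AchlioptasPeres2004, §3 p. 8 (arXiv:cs/0305009)] -/
def satCount (σ : Fin n → Bool) (c : Fin k → Fin n × Bool) : ℕ :=
  (univ.filter fun j : Fin k => σ (c j).1 = (c j).2).card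

/-- The clause weight `λ^{S(σ,c)} · 1[σ satisfies c]` (AP: `γ^{H(σ,c)} 1_{σ ∈ S(c)}` up to the
factor `γ^k`, `λ = γ²`). [cite: AchlioptasPeres2004, §3 p. 8 and §2.3 eq. (16)] -/
def clauseWeight (lam : ℝ) (σ : Fin n → Bool) (c : Fin k → Fin n × Bool) : ℝ :=
  if satCount σ c = 0 then 0 else lam ^ satCount σ c

/-- The weight of an assignment in a formula: the product of its clause weights
(`= λ^{S(σ,Φ)} 1[σ ⊨ Φ]`, see `assignmentWeight_eq`). [cite: AchlioptasPeres2004, §3 p. 8] -/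
def assignmentWeight (lam : ℝ) (σ : Fin n → Bool) (Φ : Fin m → Fin k → Fin n × Bool) : ℝ :=
  ∏ i, clauseWeight lam σ (Φ i)

/-- The total number `S(σ, Φ) = Σ_i S(σ, Φ_i)` of satisfied literal occurrences
(AP: `H(σ, F) = 2 S(σ, F) - km`). [cite: AchlioptasPeres2004, §3 p. 8] -/
def totalSat (σ : Fin n → Bool) (Φ : Fin m → Fin k → Fin n × Bool) : ℕ :=
  ∑ i, satCount σ (Φ i)

/-- The weighted count `X(Φ) = Σ_σ λ^{S(σ,Φ)} 1[σ ⊨ Φ]`. [cite: AchlioptasPeres2004, §3 p. 8 and §7 p. 14] -/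
def weightedCount (lam : ℝ) (Φ : Fin m → Fin k → Fin n × Bool) : ℝ :=
  ∑ σ : Fin n → Bool, assignmentWeight lam σ Φ

/-- The BALANCED weighted count `X₊(Φ) = Σ_{σ ⊨ Φ, H(σ,Φ) ≥ 0} λ^{S(σ,Φ)}`, `H ≥ 0 ⟺ 2S ≥ km`.
[cite: AchlioptasPeres2004, §7 p. 14 (S₊, X₊)] -/
def balancedCount (lam : ℝ) (Φ : Fin m → Fin k → Fin n × Bool) : ℝ :=
  ∑ σ : Fin n → Bool, if k * m ≤ 2 * totalSat σ Φ then assignmentWeight lam σ Φ else 0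

/-- The overlap `z` of two assignments: the number of variables on which they agree.
[cite: AchlioptasPeres2004, §2.1 p. 3] -/
def overlap (σ τ : Fin n → Bool) : ℕ :=
  (univ.filter fun v : Fin n => σ v = τ v).card

/-- The pair-correlation polynomial `F_λ(α) = (αλ² + α + 2λ(1-α))^k - 2(α + λ(1-α))^k + α^k`,
i.e. `f(α)` of AP eq. (19) written with `λ = 1 - ε`. [cite: AchlioptasPeres2004, eq. (18)–(19) p. 9] -/
def pairPoly (k : ℕ) (lam α : ℝ) : ℝ :=
  (α * lam ^ 2 + α + 2 * lam * (1 - α)) ^ k - 2 * (α + lam * (1 - α)) ^ k + α ^ k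

/-! ### Pointwise facts -/

/-- `S(σ, c) ≤ k`. [folklore] -/
theorem satCount_le (σ : Fin n → Bool) (c : Fin k → Fin n × Bool) : satCount σ c ≤ k := by
  unfold satCount
  exact (card_filter_le _ _).trans (by simp)

/-- Clause weights are non-negative for `λ ≥ 0`. [folklore] -/
theorem clauseWeight_nonneg {lam : ℝ} (h : 0 ≤ lam) (σ : Fin n → Bool)
    (c : Fin k → Fin n × Bool) : 0 ≤ clauseWeight lam σ c := by
  unfold clauseWeight; split_ifs <;> positivity

/-- Assignment weights are non-negative for `λ ≥ 0`. [folklore] -/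
theorem assignmentWeight_nonneg {lam : ℝ} (h : 0 ≤ lam) (σ : Fin n → Bool)
    (Φ : Fin m → Fin k → Fin n × Bool) : 0 ≤ assignmentWeight lam σ Φ :=
  Finset.prod_nonneg fun i _ => clauseWeight_nonneg h σ (Φ i)

/-- `X(Φ) ≥ 0` for `λ ≥ 0`. [folklore] -/
theorem weightedCount_nonneg {lam : ℝ} (h : 0 ≤ lam) (Φ : Fin m → Fin k → Fin n × Bool) :
    0 ≤ weightedCount lam Φ :=
  Finset.sum_nonneg fun σ _ => assignmentWeight_nonneg h σ Φ

/-- `X₊(Φ) ≥ 0` for `λ ≥ 0`. [folklore] -/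
theorem balancedCount_nonneg {lam : ℝ} (h : 0 ≤ lam) (Φ : Fin m → Fin k → Fin n × Bool) :
    0 ≤ balancedCount lam Φ := by
  refine Finset.sum_nonneg fun σ _ => ?_
  split_ifs
  · exact assignmentWeight_nonneg h σ Φ
  · exact le_rfl

/-- `X₊ ≤ X` for `λ ≥ 0`. [cite: AchlioptasPeres2004, §7 p. 14] -/
theorem balancedCount_le_weightedCount {lam : ℝ} (h : 0 ≤ lam)
    (Φ : Fin m → Fin k → Fin n × Bool) : balancedCount lam Φ ≤ weightedCount lam Φ := by
  refine Finset.sum_le_sum fun σ _ => ?_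
  split_ifs
  · exact le_rfl
  · exact assignmentWeight_nonneg h σ Φ

/-- The assignment weight in closed form: `λ^{S(σ,Φ)}` if `σ` satisfies every clause, else `0`.
[cite: AchlioptasPeres2004, §3 p. 8] -/
theorem assignmentWeight_eq (lam : ℝ) (σ : Fin n → Bool) (Φ : Fin m → Fin k → Fin n × Bool) :
    assignmentWeight lam σ Φ =
      if ∃ i, satCount σ (Φ i) = 0 then 0 else lam ^ totalSat σ Φ := by
  unfold assignmentWeight totalSat
  split_ifs with h
  · obtain ⟨i, hi⟩ := h
    apply Finset.prod_eq_zero (Finset.mem_univ i)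
    simp [clauseWeight, hi]
  · push Not at h
    rw [← Finset.prod_pow_eq_pow_sum]
    refine Finset.prod_congr rfl fun i _ => ?_
    simp [clauseWeight, h i]

/-- A positive assignment weight certifies satisfaction of every clause. [folklore] -/
theorem forall_exists_of_assignmentWeight_ne_zero {lam : ℝ} {σ : Fin n → Bool}
    {Φ : Fin m → Fin k → Fin n × Bool} (h : assignmentWeight lam σ Φ ≠ 0) :
    ∀ i : Fin m, ∃ j : Fin k, σ (Φ i j).1 = (Φ i j).2 := by
  intro i
  rw [assignmentWeight_eq] at h
  split_ifs at h with h'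
  · exact absurd rfl h
  · push Not at h'
    have hi := h' i
    unfold satCount at hi
    obtain ⟨j, hj⟩ := Finset.card_pos.mp (Nat.pos_of_ne_zero hi)
    exact ⟨j, (Finset.mem_filter.mp hj).2⟩

/-- `X₊(Φ) > 0` implies that `Φ` is satisfiable. [cite: AchlioptasPeres2004, §2.3 p. 5 ("X > 0 implies S ≠ ∅")] -/
theorem litArraySat_of_balancedCount_pos {lam : ℝ} {Φ : Fin m → Fin k → Fin n × Bool}
    (h : 0 < balancedCount lam Φ) : LitArraySat Φ := by
  unfold balancedCount at h
  obtain ⟨σ, _, hσ⟩ := Finset.exists_ne_zero_of_sum_ne_zero h.ne'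
  refine ⟨σ, forall_exists_of_assignmentWeight_ne_zero (lam := lam) ?_⟩
  intro h0
  apply hσ
  simp [h0]

/-! ### Product forms of the clause weight -/

/-- `λ^{S(σ,c)} = ∏_j (λ if σ ⊨ c_j else 1)`. [folklore] -/
theorem pow_satCount_eq_prod (lam : ℝ) (σ : Fin n → Bool) (c : Fin k → Fin n × Bool) :
    lam ^ satCount σ c = ∏ j, (if σ (c j).1 = (c j).2 then lam else 1) := by
  rw [Finset.prod_ite, Finset.prod_const, Finset.prod_const_one, mul_one, satCount]

/-- `1[σ ⊭ c] = ∏_j (0 if σ ⊨ c_j else 1)`. [folklore] -/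
theorem ite_satCount_eq_prod (σ : Fin n → Bool) (c : Fin k → Fin n × Bool) :
    (if satCount σ c = 0 then (1 : ℝ) else 0) = ∏ j, (if σ (c j).1 = (c j).2 then (0 : ℝ) else 1) := by
  rw [Finset.prod_ite, Finset.prod_const, Finset.prod_const_one, mul_one, satCount]
  split_ifs with h
  · rw [h, pow_zero]
  · rw [zero_pow h]

/-- `clauseWeight λ σ c = ∏_j a(c_j) - ∏_j b(c_j)` with `a = (λ if true else 1)`,
`b = (0 if true else 1)` — the inclusion–exclusion `λ^s 1[s≥1] = λ^s - 1[s=0]` behind AP (17).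
[cite: AchlioptasPeres2004, §3.1 p. 8] -/
theorem clauseWeight_eq_prod_sub_prod (lam : ℝ) (σ : Fin n → Bool) (c : Fin k → Fin n × Bool) :
    clauseWeight lam σ c = (∏ j, (if σ (c j).1 = (c j).2 then lam else 1)) -
      ∏ j, (if σ (c j).1 = (c j).2 then (0 : ℝ) else 1) := by
  rw [← pow_satCount_eq_prod, ← ite_satCount_eq_prod, clauseWeight]
  split_ifs with h
  · rw [h, pow_zero, sub_self]
  · rw [sub_zero]

/-! ### Per-literal sums -/

/-- A fixed assignment satisfies exactly `n` of the `2n` literals: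
`Σ_ℓ (x if σ ⊨ ℓ else y) = n x + n y`. [cite: AchlioptasPeres2004, §3.1 p. 8] -/
theorem sum_literals_ite (σ : Fin n → Bool) (x y : ℝ) :
    ∑ ℓ : Fin n × Bool, (if σ ℓ.1 = ℓ.2 then x else y) = n * x + n * y := by
  rw [Fintype.sum_prod_type]
  simp only [Fintype.sum_bool]
  have : ∀ v : Fin n, ((if σ v = true then x else y) + if σ v = false then x else y) = x + y := by
    intro v; cases σ v <;> simp [add_comm]
  simp only [this, Finset.sum_const, Finset.card_univ, Fintype.card_fin, nsmul_eq_mul]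
  ring

/-- Joint literal statistics of a pair of overlap `z`:
`Σ_ℓ (x|y as σ ⊨ ℓ) · (x'|y' as τ ⊨ ℓ) = z (x x' + y y') + (n - z) (x y' + y x')`.
[cite: AchlioptasPeres2004, §3.2 p. 9] -/
theorem sum_literals_ite_mul_ite (σ τ : Fin n → Bool) (x y x' y' : ℝ) :
    ∑ ℓ : Fin n × Bool, ((if σ ℓ.1 = ℓ.2 then x else y) * (if τ ℓ.1 = ℓ.2 then x' else y')) =
      overlap σ τ * (x * x' + y * y') + ((n : ℝ) - overlap σ τ) * (x * y' + y * x') := by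
  rw [Fintype.sum_prod_type]
  simp only [Fintype.sum_bool]
  have key : ∀ v : Fin n,
      ((if σ v = true then x else y) * (if τ v = true then x' else y') +
        (if σ v = false then x else y) * (if τ v = false then x' else y')) =
      if σ v = τ v then x * x' + y * y' else x * y' + y * x' := by
    intro v; cases σ v <;> cases τ v <;> simp <;> ring
  simp only [key]
  rw [Finset.sum_ite, Finset.sum_const, Finset.sum_const, nsmul_eq_mul, nsmul_eq_mul]
  have hcard : ((univ.filter fun v : Fin n => ¬σ v = τ v).card : ℝ) = (n : ℝ) - overlap σ τ := by
    have h := Finset.card_filter_add_card_filter_not (s := (univ : Finset (Fin n)))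
      (fun v : Fin n => σ v = τ v)
    rw [Finset.card_univ, Fintype.card_fin] at h
    unfold overlap
    have h' : ((univ.filter fun v : Fin n => σ v = τ v).card : ℝ) +
        ((univ.filter fun v : Fin n => ¬σ v = τ v).card : ℝ) = n := by exact_mod_cast h
    linarith
  rw [hcard]
  rfl

/-! ### Per-clause sums -/

/-- **First moment per clause** (AP (17), `2^k γ^k ψ(γ)` in our normalisation):
`Σ_c clauseWeight λ σ c = n^k ((1+λ)^k - 1)`, independent of `σ`.
[cite: AchlioptasPeres2004, §3.1 eq. (17) p. 8] -/
theorem sum_clauseWeight (lam : ℝ) (σ : Fin n → Bool) :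
    ∑ c : Fin k → Fin n × Bool, clauseWeight lam σ c = (n : ℝ) ^ k * ((1 + lam) ^ k - 1) := by
  simp only [clauseWeight_eq_prod_sub_prod, Finset.sum_sub_distrib]
  rw [← Fintype.sum_pow (fun ℓ : Fin n × Bool => if σ ℓ.1 = ℓ.2 then lam else 1) k,
    ← Fintype.sum_pow (fun ℓ : Fin n × Bool => if σ ℓ.1 = ℓ.2 then (0 : ℝ) else 1) k,
    sum_literals_ite, sum_literals_ite]
  have e : (n : ℝ) * lam + n * 1 = n * (1 + lam) := by ring
  rw [e, mul_pow]
  ring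

/-- **Second moment per clause** (AP (18)): for a pair of overlap `z`,
`Σ_c w_λ(σ,c) w_λ(τ,c) = (zλ² + z + 2λ(n-z))^k - 2(z + λ(n-z))^k + z^k`.
[cite: AchlioptasPeres2004, §3.2 eq. (18) p. 9] -/
theorem sum_clauseWeight_mul (lam : ℝ) (σ τ : Fin n → Bool) :
    ∑ c : Fin k → Fin n × Bool, clauseWeight lam σ c * clauseWeight lam τ c =
      ((overlap σ τ : ℝ) * lam ^ 2 + overlap σ τ + 2 * lam * ((n : ℝ) - overlap σ τ)) ^ k -
        2 * ((overlap σ τ : ℝ) + lam * ((n : ℝ) - overlap σ τ)) ^ k + (overlap σ τ : ℝ) ^ k := by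
  simp only [clauseWeight_eq_prod_sub_prod, sub_mul, mul_sub, ← Finset.prod_mul_distrib,
    Finset.sum_sub_distrib]
  rw [← Fintype.sum_pow (fun ℓ : Fin n × Bool =>
        (if σ ℓ.1 = ℓ.2 then lam else 1) * (if τ ℓ.1 = ℓ.2 then lam else 1)) k,
    ← Fintype.sum_pow (fun ℓ : Fin n × Bool =>
        (if σ ℓ.1 = ℓ.2 then (0 : ℝ) else 1) * (if τ ℓ.1 = ℓ.2 then lam else 1)) k,
    ← Fintype.sum_pow (fun ℓ : Fin n × Bool =>
        (if σ ℓ.1 = ℓ.2 then lam else 1) * (if τ ℓ.1 = ℓ.2 then (0 : ℝ) else 1)) k,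
    ← Fintype.sum_pow (fun ℓ : Fin n × Bool =>
        (if σ ℓ.1 = ℓ.2 then (0 : ℝ) else 1) * (if τ ℓ.1 = ℓ.2 then (0 : ℝ) else 1)) k,
    sum_literals_ite_mul_ite, sum_literals_ite_mul_ite, sum_literals_ite_mul_ite,
    sum_literals_ite_mul_ite]
  ring

/-- The same in terms of `F_λ`: for `n ≥ 1`, `Σ_c w_λ(σ,c) w_λ(τ,c) = n^k F_λ(z/n)`.
[cite: AchlioptasPeres2004, eq. (18)–(19) p. 9] -/
theorem sum_clauseWeight_mul_eq_pairPoly (hn : 1 ≤ n) (lam : ℝ) (σ τ : Fin n → Bool) :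
    ∑ c : Fin k → Fin n × Bool, clauseWeight lam σ c * clauseWeight lam τ c =
      (n : ℝ) ^ k * pairPoly k lam (overlap σ τ / n) := by
  rw [sum_clauseWeight_mul, pairPoly]
  have hn' : (n : ℝ) ≠ 0 := by exact_mod_cast (show n ≠ 0 by omega)
  have e1 : (overlap σ τ : ℝ) * lam ^ 2 + overlap σ τ + 2 * lam * ((n : ℝ) - overlap σ τ) =
      n * (overlap σ τ / n * lam ^ 2 + overlap σ τ / n + 2 * lam * (1 - overlap σ τ / n)) := by
    field_simp
  have e2 : (overlap σ τ : ℝ) + lam * ((n : ℝ) - overlap σ τ) =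
      n * (overlap σ τ / n + lam * (1 - overlap σ τ / n)) := by
    field_simp
  have e3 : (overlap σ τ : ℝ) ^ k = (n : ℝ) ^ k * (overlap σ τ / n) ^ k := by
    rw [← mul_pow]; congr 1; field_simp
  rw [e1, e2, mul_pow, mul_pow, e3]
  ring

/-- `F_λ(1/2) = 2^{-k} ((1+λ)^k - 1)²`: at overlap `n/2` the pair weight is the square of the
single weight (AP p. 5: "`f_w(1/2) = E[w]²`"; (25)). [cite: AchlioptasPeres2004, §2.3 p. 5, eq. (25) p. 10] -/
theorem pairPoly_half (k : ℕ) (lam : ℝ) :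
    pairPoly k lam (1 / 2) = ((1 + lam) ^ k - 1) ^ 2 / 2 ^ k := by
  unfold pairPoly
  have e1 : (1 / 2 * lam ^ 2 + 1 / 2 + 2 * lam * (1 - 1 / 2) : ℝ) = (1 + lam) ^ 2 / 2 := by ring
  have e2 : (1 / 2 + lam * (1 - 1 / 2) : ℝ) = (1 + lam) / 2 := by ring
  rw [e1, e2, div_pow, div_pow, div_pow, one_pow, ← pow_mul]
  field_simp
  ring

/-! ### Sums over arrays: the `m` clauses are i.i.d. -/

/-- Sums of clause-wise products over all arrays factor: `Σ_Φ ∏_i g(Φ_i) = (Σ_c g(c))^m`.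
[cite: AchlioptasPeres2004, §3.1 (17) / §3.2 (20) ("since the clauses are i.i.d.")] -/
theorem sum_arrays_prod (g : (Fin k → Fin n × Bool) → ℝ) :
    ∑ Φ : Fin m → Fin k → Fin n × Bool, ∏ i, g (Φ i) = (∑ c : Fin k → Fin n × Bool, g c) ^ m :=
  (Fintype.sum_pow g m).symm

/-- **The first moment** (AP (17)): `Σ_Φ X(Φ) = 2^n · (n^k ((1+λ)^k - 1))^m`.
[cite: AchlioptasPeres2004, §3.1 eq. (17) p. 9] -/
theorem sum_weightedCount (lam : ℝ) :
    ∑ Φ : Fin m → Fin k → Fin n × Bool, weightedCount lam Φ =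
      2 ^ n * ((n : ℝ) ^ k * ((1 + lam) ^ k - 1)) ^ m := by
  unfold weightedCount assignmentWeight
  rw [Finset.sum_comm]
  simp only [sum_arrays_prod, sum_clauseWeight, Finset.sum_const, Finset.card_univ,
    Fintype.card_fun, Fintype.card_bool, Fintype.card_fin, nsmul_eq_mul]
  push_cast
  ring

/-- **The second moment, pair by pair** (AP (20)): `Σ_Φ W_λ(σ,Φ) W_λ(τ,Φ) = (Σ_c w_λ(σ,c) w_λ(τ,c))^m`.
[cite: AchlioptasPeres2004, §3.2 eq. (20) p. 9] -/
theorem sum_assignmentWeight_mul (lam : ℝ) (σ τ : Fin n → Bool) :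
    ∑ Φ : Fin m → Fin k → Fin n × Bool, assignmentWeight lam σ Φ * assignmentWeight lam τ Φ =
      (∑ c : Fin k → Fin n × Bool, clauseWeight lam σ c * clauseWeight lam τ c) ^ m := by
  unfold assignmentWeight
  simp only [← Finset.prod_mul_distrib]
  exact sum_arrays_prod (fun c => clauseWeight lam σ c * clauseWeight lam τ c)

/-! ### Pair counting: `2^n C(n,z)` ordered pairs of overlap `z` -/

/-- For a fixed `σ`, the agreement set `{v | σ v = τ v}` determines `τ`: an equivalence between
assignments and subsets of the variables. [folklore] -/
def agreementEquiv (σ : Fin n → Bool) : (Fin n → Bool) ≃ Finset (Fin n) where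
  toFun τ := univ.filter fun v => σ v = τ v
  invFun A := fun v => if v ∈ A then σ v else !σ v
  left_inv τ := by
    funext v
    by_cases h : σ v = τ v
    · simp [h]
    · simp only [Finset.mem_filter, Finset.mem_univ, true_and, h, if_false]
      cases hσ : σ v <;> cases hτ : τ v <;> simp_all
  right_inv A := by
    ext v
    by_cases h : v ∈ A <;> simp [h]

/-- **Pair counting** (AP (21)): `Σ_σ Σ_τ g(overlap(σ,τ)) = 2^n Σ_{z=0}^{n} C(n,z) g(z)` — there are
`2^n C(n,z)` ordered pairs of assignments with overlap `z`.
[cite: AchlioptasPeres2004, §3.2 eq. (21) p. 10] -/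
theorem sum_sum_overlap (g : ℕ → ℝ) :
    ∑ σ : Fin n → Bool, ∑ τ : Fin n → Bool, g (overlap σ τ) =
      2 ^ n * ∑ z ∈ range (n + 1), (n.choose z : ℝ) * g z := by
  have inner : ∀ σ : Fin n → Bool, ∑ τ : Fin n → Bool, g (overlap σ τ) =
      ∑ z ∈ range (n + 1), (n.choose z : ℝ) * g z := by
    intro σ
    have h1 : ∑ τ : Fin n → Bool, g (overlap σ τ) = ∑ A : Finset (Fin n), g A.card := by
      refine Fintype.sum_equiv (agreementEquiv σ) _ _ fun τ => ?_
      rfl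
    rw [h1, ← Finset.powerset_univ, Finset.sum_powerset_apply_card]
    simp only [Finset.card_univ, Fintype.card_fin, nsmul_eq_mul]
  simp only [inner, Finset.sum_const, Finset.card_univ, Fintype.card_fun, Fintype.card_bool,
    Fintype.card_fin, nsmul_eq_mul]
  push_cast
  ring

/-! ### Truncation: comparing balanced pairs at two values of `λ` (AP §7 (49)–(50)) -/

/-- **The truncation trick** (AP (49)): for `0 ≤ λ ≤ λ'` and a pair `σ, τ` that are both balanced
in `Φ` (`2 S ≥ km`), `W_λ(σ,Φ) W_λ(τ,Φ) ≤ (λ/λ')^{km} W_{λ'}(σ,Φ) W_{λ'}(τ,Φ)` (since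
`λ^{S_σ+S_τ} = (λ/λ')^{S_σ+S_τ} λ'^{S_σ+S_τ}` and `S_σ + S_τ ≥ km`).
[cite: AchlioptasPeres2004, §7 eq. (49) p. 15] -/
theorem balanced_pair_le {lam lam' : ℝ} (h0 : 0 ≤ lam) (h1 : lam ≤ lam') (hl' : 0 < lam')
    (σ τ : Fin n → Bool) (Φ : Fin m → Fin k → Fin n × Bool)
    (hσ : k * m ≤ 2 * totalSat σ Φ) (hτ : k * m ≤ 2 * totalSat τ Φ) :
    assignmentWeight lam σ Φ * assignmentWeight lam τ Φ ≤
      (lam / lam') ^ (k * m) * (assignmentWeight lam' σ Φ * assignmentWeight lam' τ Φ) := by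
  rw [assignmentWeight_eq, assignmentWeight_eq, assignmentWeight_eq lam', assignmentWeight_eq lam']
  have hρ0 : 0 ≤ lam / lam' := div_nonneg h0 hl'.le
  have hρ1 : lam / lam' ≤ 1 := (div_le_one hl').mpr h1
  split_ifs with ha hb
  · simp
  · simp
  · simp
  · set N := totalSat σ Φ + totalSat τ Φ with hN
    have hkm : k * m ≤ N := by omega
    have e : lam ^ totalSat σ Φ * lam ^ totalSat τ Φ =
        (lam / lam') ^ N * (lam' ^ totalSat σ Φ * lam' ^ totalSat τ Φ) := by
      rw [← pow_add, ← pow_add, ← hN, ← mul_pow, div_mul_cancel₀ _ hl'.ne']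
    rw [e]
    apply mul_le_mul_of_nonneg_right _ (by positivity)
    exact pow_le_pow_of_le_one hρ0 hρ1 hkm

/-- **Second moment of the balanced count** (AP (50)): for `0 ≤ λ ≤ λ'`,
`Σ_Φ X₊(Φ)² ≤ Σ_{σ,τ} min( (Σ_c w_λ(σ,c)w_λ(τ,c))^m , (λ/λ')^{km} (Σ_c w_{λ'}(σ,c)w_{λ'}(τ,c))^m )`.
[cite: AchlioptasPeres2004, §7 eq. (49)–(50) p. 15] -/
theorem sum_balancedCount_sq_le {lam lam' : ℝ} (h0 : 0 ≤ lam) (h1 : lam ≤ lam') (hl' : 0 < lam') :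
    ∑ Φ : Fin m → Fin k → Fin n × Bool, balancedCount lam Φ ^ 2 ≤
      ∑ σ : Fin n → Bool, ∑ τ : Fin n → Bool,
        min ((∑ c : Fin k → Fin n × Bool, clauseWeight lam σ c * clauseWeight lam τ c) ^ m)
          ((lam / lam') ^ (k * m) *
            (∑ c : Fin k → Fin n × Bool, clauseWeight lam' σ c * clauseWeight lam' τ c) ^ m) := by
  have hl'0 : 0 ≤ lam' := hl'.le
  -- expand the square and exchange the sums
  have hsq : ∀ Φ : Fin m → Fin k → Fin n × Bool, balancedCount lam Φ ^ 2 =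
      ∑ σ : Fin n → Bool, ∑ τ : Fin n → Bool,
        (if k * m ≤ 2 * totalSat σ Φ then assignmentWeight lam σ Φ else 0) *
          (if k * m ≤ 2 * totalSat τ Φ then assignmentWeight lam τ Φ else 0) := by
    intro Φ
    rw [sq, balancedCount, Finset.sum_mul_sum]
  simp only [hsq]
  rw [Finset.sum_comm]
  refine Finset.sum_le_sum fun σ _ => ?_
  rw [Finset.sum_comm]
  refine Finset.sum_le_sum fun τ _ => ?_
  refine le_min ?_ ?_
  · rw [← sum_assignmentWeight_mul]
    refine Finset.sum_le_sum fun Φ _ => ?_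
    have ha := assignmentWeight_nonneg h0 σ Φ
    have hb := assignmentWeight_nonneg h0 τ Φ
    split_ifs <;> nlinarith
  · rw [← sum_assignmentWeight_mul, Finset.mul_sum]
    refine Finset.sum_le_sum fun Φ _ => ?_
    have ha := assignmentWeight_nonneg hl'0 σ Φ
    have hb := assignmentWeight_nonneg hl'0 τ Φ
    have hρ : 0 ≤ (lam / lam') ^ (k * m) := by positivity
    split_ifs with hσ hτ
    · exact balanced_pair_le h0 h1 hl' σ τ Φ hσ hτ
    · rw [mul_zero]; positivity
    · rw [zero_mul]; positivity
    · rw [zero_mul]; positivity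

/-! ### The second-moment inequality in counting form (AP Lemma 1) -/

/-- Cauchy–Schwarz for a non-negative finite family: `(Σ f)² ≤ #{f > 0} · Σ f²`. [folklore] -/
theorem sq_sum_le_card_pos_mul_sum_sq {ι : Type*} (s : Finset ι) (f : ι → ℝ)
    (hf : ∀ i ∈ s, 0 ≤ f i) :
    (∑ i ∈ s, f i) ^ 2 ≤ ((s.filter fun i => 0 < f i).card : ℝ) * ∑ i ∈ s, f i ^ 2 := by
  have hsplit : ∑ i ∈ s, f i = ∑ i ∈ s.filter (fun i => 0 < f i), f i * 1 := by
    rw [Finset.sum_filter]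
    refine Finset.sum_congr rfl fun i hi => ?_
    split_ifs with h
    · rw [mul_one]
    · linarith [hf i hi, le_antisymm (not_lt.mp h) (hf i hi)]
  rw [hsplit]
  calc (∑ i ∈ s.filter (fun i => 0 < f i), f i * 1) ^ 2
      ≤ (∑ i ∈ s.filter (fun i => 0 < f i), f i ^ 2) *
          ∑ i ∈ s.filter (fun i => 0 < f i), (1 : ℝ) ^ 2 := Finset.sum_mul_sq_le_sq_mul_sq _ _ _
    _ = ((s.filter fun i => 0 < f i).card : ℝ) * ∑ i ∈ s.filter (fun i => 0 < f i), f i ^ 2 := by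
          rw [one_pow, Finset.sum_const, nsmul_eq_mul, mul_one, mul_comm]
    _ ≤ ((s.filter fun i => 0 < f i).card : ℝ) * ∑ i ∈ s, f i ^ 2 := by
          apply mul_le_mul_of_nonneg_left _ (Nat.cast_nonneg _)
          exact Finset.sum_le_sum_of_subset_of_nonneg (Finset.filter_subset _ _)
            fun i _ _ => sq_nonneg (f i)

/-- **AP Lemma 1 in counting form**: `(Σ_Φ X₊(Φ))² ≤ #{Φ satisfiable} · Σ_Φ X₊(Φ)²` for `λ ≥ 0`
(Cauchy–Schwarz, and `X₊(Φ) > 0 ⇒ Φ` satisfiable). Dividing by `(2n)^{km}` this reads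
`Pr[F_k(n,m) sat] ≥ E[X₊]² / E[X₊²]`. [cite: AchlioptasPeres2004, Lemma 1 (arXiv:cs/0305009 p. 3)] -/
theorem sq_sum_balancedCount_le {lam : ℝ} (h0 : 0 ≤ lam) :
    (∑ Φ : Fin m → Fin k → Fin n × Bool, balancedCount lam Φ) ^ 2 ≤
      ((univ.filter fun Φ : Fin m → Fin k → Fin n × Bool => LitArraySat Φ).card : ℝ) *
        ∑ Φ : Fin m → Fin k → Fin n × Bool, balancedCount lam Φ ^ 2 := by
  have h := sq_sum_le_card_pos_mul_sum_sq (univ : Finset (Fin m → Fin k → Fin n × Bool))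
    (fun Φ => balancedCount lam Φ) fun Φ _ => balancedCount_nonneg h0 Φ
  refine h.trans (mul_le_mul_of_nonneg_right ?_ (Finset.sum_nonneg fun Φ _ => sq_nonneg _))
  have hsub : (univ.filter fun Φ : Fin m → Fin k → Fin n × Bool => 0 < balancedCount lam Φ) ⊆
      (univ.filter fun Φ : Fin m → Fin k → Fin n × Bool => LitArraySat Φ) := by
    intro Φ hΦ
    simp only [Finset.mem_filter, Finset.mem_univ, true_and] at hΦ ⊢
    exact litArraySat_of_balancedCount_pos hΦ
  exact_mod_cast Finset.card_le_card hsub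

end RandomKSat

end Literature.Computability.Complexity

end
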